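import Literature.Analysis.FluidPDE.BeltramiDirections
import Literature.Analysis.FunctionSpaces.TorusTrigPoly
import HarnessLib

/-!
# Beltrami waves on `T³` (Buckmaster–Vicol 2019, Prop. 3.1; Luo–Titi 2020, Prop. 1)

Analysis/FluidPDE support file, third building block of the intermittent convex-integration
scheme in the explicit form of T. Luo and E. S. Titi, Calc. Var. PDE 59 (2020) =
arXiv:1808.07595, §3.2, **Proposition 1** (= Buckmaster–Vicol, Ann. of Math. 189 (2019),
Prop. 3.1, after De Lellis–Székelyhidi):

> Given `ξ ∈ 𝕊² ∩ ℚ³`, let `A_ξ ∈ 𝕊² ∩ ℚ³` be such that `A_ξ · ξ = 0`, `|A_ξ| = 1`,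
> `A_{-ξ} = A_ξ`. Let `Λ` be a given finite subset of `𝕊²` such that `-Λ = Λ`, and `λ ∈ ℤ` be
> such that `λΛ ⊂ ℤ³`. Then for any choice of coefficients `a_ξ ∈ ℂ` with `a_ξ^* = a_{-ξ}` the
> vector field `W(x) = ∑_{ξ ∈ Λ} a_ξ B_ξ e^{iλξ·x}`, with `B_ξ = (A_ξ + iξ × A_ξ)/√2`, is
> real-valued, divergence-free and satisfies `∇ × W = λW`, `∇·(W ⊗ W) = ∇(|W|²/2)`.
> Furthermore, `⟨W ⊗ W⟩ := ⨍ W ⊗ W dx = ∑_{ξ∈Λ} ½|a_ξ|² (Id - ξ ⊗ ξ)`.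

Here `Λ` is the twelve-element direction set of `BeltramiDirections` (`dir : LIndex → ℝ³`,
`5Λ ⊂ ℤ³`, frame `A_ξ = adir`, `ξ × A_ξ = cdir`), the admissible frequencies are `λ = 5n`,
`n ∈ ℤ` (so that `λξ = n · (5ξ) ∈ ℤ³`), and everything is transported to the unit torus
`T³ = (ℝ/ℤ)³` of the tree (`e^{iλξ·x}` ↦ `e_{λξ}(x) = e^{2πi λξ·x}`, `UnitAddTorus.mFourier`), on
which `W` is a real trigonometric polynomial (`Torus.realTrigPoly`) and the eigenvalue of `curl`
becomes `2πλ`.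

## Contents (all proved)

* `bvec y = B_ξ ∈ ℂ³` and its algebra: `B_{-ξ} = B̄_ξ` (`bvec_neg`), `ξ · B_ξ = 0`
  (`sum_dir_mul_bvec`), `|B_ξ| = 1` coordinatewise-summed (`sum_normSq_bvec`), and the tensor
  identity `B_ξ ⊗ B̄_ξ + B̄_ξ ⊗ B_ξ = Id - ξ ⊗ ξ` (`bvec_mul_conj_add`), the printed
  "`B_ξ ⊗ B_{-ξ} + B_{-ξ} ⊗ B_ξ = Id - ξ ⊗ ξ`";
* `kvec n y = λξ ∈ ℤ³` (`λ = 5n`), `kvec_neg`, `sum_kvec_mul_bvec` (`(λξ) · B_ξ = 0`),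
  `kvec_injective` (`n ≠ 0`);
* for a coefficient family `a : LIndex → ℂ` (the `a_ξ`): the frequency set `freqSet n = λΛ`,
  the Fourier-side coefficients `coef n a (λξ) = a_ξ B_ξ` (fibrewise sums, so that no
  injectivity is needed), conjugate symmetry of `coef` under `a_{-ξ} = ā_ξ` (`IsCoefSymm`,
  `isConjSymm_coef`) and transversality (`isTransversal_coef`);
* **the Beltrami field** `beltramiField n a = W`, a real trigonometric polynomial, with
  `complexify ∘ W = ∑_ξ a_ξ e_{λξ} • B_ξ` (`complexify_beltramiField` — "`W` is real-valued"),
  smoothness, `div W = 0` (`isDivFree_beltramiField`), its Fourier coefficients, and the `L²`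
  identity `∫_{T³} ‖W‖² = ∑_ξ |a_ξ|²` for `n ≠ 0` (`integral_norm_sq_beltramiField`, the trace
  of the printed `⨍ W ⊗ W`).

The remaining clauses of Prop. 1 — `curl W = 2πλ W`, `∇·(W⊗W) = ∇(|W|²/2)` and the full mean
tensor `⨍ W ⊗ W = ½∑|a_ξ|²(Id - ξ⊗ξ)` — are the sibling file `BeltramiWavesCurl`.

## References

* T. Luo, E. S. Titi, Calc. Var. PDE 59 (2020) = arXiv:1808.07595, §3.2 Prop. 1. [`LuoTiti2020`]
* T. Buckmaster, V. Vicol, Ann. of Math. 189 (2019) = arXiv:1709.10033, §3.1 Prop. 3.1, §3.2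
  (3.11). [`BuckmasterVicol2019AnnMath`]
-/

noncomputable section

open Finset UnitAddTorus Complex
open scoped BigOperators ComplexConjugate

namespace Literature.Analysis.FluidPDE.IntermittentBeltrami

open FunctionSpaces FunctionSpaces.Torus FunctionSpaces.EuclideanSpace

local notation "𝕋³" => UnitAddTorus (Fin 3)
local notation "ℂ³" => EuclideanSpace ℂ (Fin 3)
local notation "ℝ³" => EuclideanSpace ℝ (Fin 3)

/-! ## The complex vectors `B_ξ` -/

/-- **`B_ξ = (A_ξ + i ξ × A_ξ)/√2 ∈ ℂ³`** for `ξ ∈ Λ` (`A_ξ = adir`, `ξ × A_ξ = cdir`).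
[cite: LuoTiti2020, §3.2 Prop. 1] -/
def bvec (y : LIndex) : ℂ³ :=
  WithLp.toLp 2 fun i => ((Real.sqrt 2 : ℝ) : ℂ)⁻¹ * (((adir y i : ℝ) : ℂ) + I * ((cdir y i : ℝ) : ℂ))

/-- Coordinates of `B_ξ`. [folklore] -/
theorem bvec_apply (y : LIndex) (i : Fin 3) :
    bvec y i = ((Real.sqrt 2 : ℝ) : ℂ)⁻¹ * (((adir y i : ℝ) : ℂ) + I * ((cdir y i : ℝ) : ℂ)) := rfl

/-- `(√2)⁻¹ · (√2)⁻¹ = 1/2` in `ℂ`. [folklore] -/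
theorem inv_sqrt_two_mul_self : (((Real.sqrt 2 : ℝ) : ℂ)⁻¹ * ((Real.sqrt 2 : ℝ) : ℂ)⁻¹) = 1 / 2 := by
  rw [← mul_inv, ← Complex.ofReal_mul, Real.mul_self_sqrt zero_le_two]
  norm_num

/-- **`B_{-ξ} = conj B_ξ`** (`A_{-ξ} = A_ξ`, `(-ξ) × A_{-ξ} = -(ξ × A_ξ)`).
[cite: BuckmasterVicol2019AnnMath, Prop. 3.1] -/
theorem bvec_neg (x : PIndex) (b : Bool) : bvec (x, !b) = conjVec (bvec (x, b)) := by
  ext i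
  rw [conjVec_apply, bvec_apply, bvec_apply, adir_neg, cdir_neg]
  simp only [Pi.neg_apply, Complex.ofReal_neg, map_mul, map_add, map_inv₀, Complex.conj_ofReal,
    Complex.conj_I]
  ring

/-- **`ξ · B_ξ = 0`** (`ξ ⊥ A_ξ`, `ξ ⊥ ξ × A_ξ`). [cite: BuckmasterVicol2019AnnMath, Prop. 3.1] -/
theorem sum_dir_mul_bvec (y : LIndex) : ∑ i, ((dir y i : ℝ) : ℂ) * bvec y i = 0 := by
  simp only [bvec_apply]
  have h1 : ∑ i, ((dir y i : ℝ) : ℂ) * ((adir y i : ℝ) : ℂ) = 0 := by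
    rw [← Complex.ofReal_zero, ← sum_dir_mul_adir y]
    push_cast
    rfl
  have h2 : ∑ i, ((dir y i : ℝ) : ℂ) * ((cdir y i : ℝ) : ℂ) = 0 := by
    rw [← Complex.ofReal_zero, ← sum_dir_mul_cdir y]
    push_cast
    rfl
  calc ∑ i, ((dir y i : ℝ) : ℂ) * (((Real.sqrt 2 : ℝ) : ℂ)⁻¹ * (((adir y i : ℝ) : ℂ) + I * ((cdir y i : ℝ) : ℂ)))
      = ((Real.sqrt 2 : ℝ) : ℂ)⁻¹ * (∑ i, ((dir y i : ℝ) : ℂ) * ((adir y i : ℝ) : ℂ)) +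
          ((Real.sqrt 2 : ℝ) : ℂ)⁻¹ * I * (∑ i, ((dir y i : ℝ) : ℂ) * ((cdir y i : ℝ) : ℂ)) := by
        rw [Finset.mul_sum, Finset.mul_sum, ← Finset.sum_add_distrib]
        refine Finset.sum_congr rfl fun i _ => ?_
        ring
    _ = 0 := by rw [h1, h2]; ring

/-- **The tensor identity `B_ξ ⊗ B̄_ξ + B̄_ξ ⊗ B_ξ = Id - ξ ⊗ ξ`**, entrywise in `ℂ`:
`(B_ξ)ᵢ conj(B_ξ)ⱼ + conj(B_ξ)ᵢ (B_ξ)ⱼ = δᵢⱼ - ξᵢξⱼ` (the printed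
"`B_ξ ⊗ B_{-ξ} + B_{-ξ} ⊗ B_ξ = Id - ξ ⊗ ξ`", via `A⊗A + (ξ×A)⊗(ξ×A) = Id - ξ⊗ξ`).
[cite: BuckmasterVicol2019AnnMath, Prop. 3.1] -/
theorem bvec_mul_conj_add (y : LIndex) (i j : Fin 3) :
    bvec y i * conj (bvec y j) + conj (bvec y i) * bvec y j =
      (((if i = j then (1 : ℝ) else 0) - dir y i * dir y j : ℝ) : ℂ) := by
  have h := adir_mul_adir_add_cdir_mul_cdir y i j
  rw [← h]
  simp only [bvec_apply, map_mul, map_add, map_inv₀, Complex.conj_ofReal, Complex.conj_I]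
  push_cast
  linear_combination (2 * ((adir y i : ℝ) : ℂ) * ((adir y j : ℝ) : ℂ) -
    2 * I ^ 2 * ((cdir y i : ℝ) : ℂ) * ((cdir y j : ℝ) : ℂ)) * inv_sqrt_two_mul_self -
    (((cdir y i : ℝ) : ℂ) * ((cdir y j : ℝ) : ℂ)) * Complex.I_mul_I

/-- Real and imaginary parts of the coordinates of `B_ξ`. [folklore] -/
theorem bvec_apply_re_im (y : LIndex) (i : Fin 3) :
    (bvec y i).re = (Real.sqrt 2)⁻¹ * adir y i ∧ (bvec y i).im = (Real.sqrt 2)⁻¹ * cdir y i := by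
  rw [bvec_apply, ← Complex.ofReal_inv]
  constructor
  · simp only [Complex.mul_re, Complex.add_re, Complex.add_im, Complex.ofReal_re, Complex.ofReal_im,
      Complex.mul_im, Complex.I_re, Complex.I_im]
    ring
  · simp only [Complex.mul_re, Complex.add_re, Complex.add_im, Complex.ofReal_re, Complex.ofReal_im,
      Complex.mul_im, Complex.I_re, Complex.I_im]
    ring

/-- **`|B_ξ|² = 1`**: `∑ᵢ |(B_ξ)ᵢ|² = 1` (`|A_ξ|² = |ξ × A_ξ|² = 1`). [cite: BuckmasterVicol2019AnnMath, Prop. 3.1] -/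
theorem sum_normSq_bvec (y : LIndex) : ∑ i, Complex.normSq (bvec y i) = 1 := by
  have h : ∀ i, Complex.normSq (bvec y i) =
      (Real.sqrt 2)⁻¹ * (Real.sqrt 2)⁻¹ * (adir y i * adir y i + cdir y i * cdir y i) := by
    intro i
    rw [Complex.normSq_apply, (bvec_apply_re_im y i).1, (bvec_apply_re_im y i).2]
    ring
  simp_rw [h]
  rw [← Finset.mul_sum, Finset.sum_add_distrib, sum_adir_sq, sum_cdir_sq, ← mul_inv,
    Real.mul_self_sqrt zero_le_two]
  norm_num

/-- `‖B_ξ‖ = 1` in `ℂ³`. [cite: BuckmasterVicol2019AnnMath, Prop. 3.1] -/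
theorem norm_bvec (y : LIndex) : ‖bvec y‖ = 1 := by
  rw [EuclideanSpace.norm_eq]
  simp_rw [← Complex.normSq_eq_norm_sq]
  rw [sum_normSq_bvec, Real.sqrt_one]

/-! ## The frequencies `λξ ∈ ℤ³`, `λ = 5n` -/

/-- The frequency `λξ = n · (5ξ) ∈ ℤ³` of the wave in direction `ξ ∈ Λ` (`λ = 5n`; Luo–Titi:
"`λ ∈ 5ℕ`", BV19 Remark 3.3 with `N_Λ = 5`). [cite: LuoTiti2020, §3.2] -/
def kvec (n : ℤ) (y : LIndex) : Fin 3 → ℤ := fun i => n * intDir y i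

/-- `λ(-ξ) = -(λξ)`. [folklore] -/
theorem kvec_neg (n : ℤ) (x : PIndex) (b : Bool) : kvec n (x, !b) = -kvec n (x, b) := by
  funext i
  cases b <;> simp [kvec, intDir]

/-- `λξ` as a real vector: `(kvec n y)ᵢ = 5n ξᵢ`. [folklore] -/
theorem kvec_cast (n : ℤ) (y : LIndex) (i : Fin 3) : ((kvec n y i : ℤ) : ℝ) = 5 * n * dir y i := by
  simp [kvec, dir]
  ring

/-- **`(λξ) · B_ξ = 0`** (transversality of the wave). [cite: BuckmasterVicol2019AnnMath, Prop. 3.1] -/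
theorem sum_kvec_mul_bvec (n : ℤ) (y : LIndex) : ∑ i, ((kvec n y i : ℤ) : ℂ) * bvec y i = 0 := by
  have h : ∀ i, ((kvec n y i : ℤ) : ℂ) = (5 * n : ℂ) * ((dir y i : ℝ) : ℂ) := by
    intro i
    have := kvec_cast n y i
    rw [← Complex.ofReal_intCast, this]
    push_cast
    ring
  simp_rw [h, mul_assoc, ← Finset.mul_sum, sum_dir_mul_bvec, mul_zero]

/-- For `n ≠ 0` distinct directions have distinct frequencies. [folklore] -/
theorem kvec_injective {n : ℤ} (hn : n ≠ 0) : Function.Injective (kvec n) := by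
  intro y y' h
  apply dir_injective
  funext i
  have hi := congr_fun h i
  simp only [kvec] at hi
  have : intDir y i = intDir y' i := mul_left_cancel₀ hn hi
  simp [dir, this]

/-! ## Coefficient families and the Beltrami field -/

/-- **Reality condition on the coefficients**: `a_{-ξ} = conj a_ξ`
("`a_ξ^* = a_{-ξ}`"). [cite: LuoTiti2020, §3.2 Prop. 1] -/
def IsCoefSymm (a : LIndex → ℂ) : Prop :=
  ∀ (x : PIndex) (b : Bool), a (x, !b) = conj (a (x, b))

/-- Real coefficient families that are even (`a_{-ξ} = a_ξ ∈ ℝ`) satisfy the reality condition —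
the case of the amplitudes `a_ξ = ρ^{1/2} γ_ξ(Id - R/ρ)` of the scheme. [folklore] -/
theorem isCoefSymm_of_real_even {r : LIndex → ℝ} (hr : ∀ x b, r (x, !b) = r (x, b)) :
    IsCoefSymm fun y => (r y : ℂ) := fun x b => by
  show ((r (x, !b) : ℝ) : ℂ) = conj ((r (x, b) : ℝ) : ℂ)
  rw [hr x b, Complex.conj_ofReal]

/-- The frequency set `λΛ ⊂ ℤ³` of the field. [cite: LuoTiti2020, §3.2 Prop. 1] -/
def freqSet (n : ℤ) : Finset (Fin 3 → ℤ) :=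
  Finset.univ.image (kvec n)

/-- `λΛ` is symmetric. [folklore] -/
theorem neg_mem_freqSet {n : ℤ} {k : Fin 3 → ℤ} (hk : k ∈ freqSet n) : -k ∈ freqSet n := by
  obtain ⟨⟨x, b⟩, -, rfl⟩ := Finset.mem_image.mp hk
  exact Finset.mem_image.mpr ⟨(x, !b), Finset.mem_univ _, kvec_neg n x b⟩

/-- The Fourier-side coefficient at the frequency `k`: the sum of `a_ξ B_ξ` over the directions
with `λξ = k` (a single term when `n ≠ 0`; empty, i.e. `0`, off `λΛ`). [cite: LuoTiti2020, §3.2 Prop. 1] -/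
def coef (n : ℤ) (a : LIndex → ℂ) (k : Fin 3 → ℤ) : ℂ³ :=
  ∑ y ∈ Finset.univ.filter (fun y => kvec n y = k), a y • bvec y

/-- For `n ≠ 0` the coefficient at `λξ` is the single term `a_ξ B_ξ`. [folklore] -/
theorem coef_kvec {n : ℤ} (hn : n ≠ 0) (a : LIndex → ℂ) (y : LIndex) :
    coef n a (kvec n y) = a y • bvec y := by
  rw [coef]
  have : Finset.univ.filter (fun y' => kvec n y' = kvec n y) = {y} := by
    ext y'
    simp only [Finset.mem_filter, Finset.mem_univ, true_and, Finset.mem_singleton]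
    exact ⟨fun h => kvec_injective hn h, fun h => by rw [h]⟩
  rw [this, Finset.sum_singleton]

/-- **Conjugate symmetry of the Fourier coefficients** under the reality condition:
`coef(-k) = conj (coef k)`. [cite: LuoTiti2020, §3.2 Prop. 1] -/
theorem isConjSymm_coef {a : LIndex → ℂ} (ha : IsCoefSymm a) (n : ℤ) : IsConjSymm (coef n a) := by
  intro k
  rw [coef, coef, conjVec_sum]
  -- reindex the fibre over `-k` by the involution `ξ ↦ -ξ`
  refine Finset.sum_nbij' (fun y => (y.1, !y.2)) (fun y => (y.1, !y.2)) ?_ ?_ ?_ ?_ ?_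
  · rintro ⟨x, b⟩ hy
    simp only [Finset.mem_filter, Finset.mem_univ, true_and] at hy ⊢
    rw [kvec_neg, hy, neg_neg]
  · rintro ⟨x, b⟩ hy
    simp only [Finset.mem_filter, Finset.mem_univ, true_and] at hy ⊢
    rw [kvec_neg, hy]
  · rintro ⟨x, b⟩ _; simp
  · rintro ⟨x, b⟩ _; simp
  · rintro ⟨x, b⟩ _
    simp only []
    rw [conjVec_smul, ha x b, bvec_neg, Complex.conj_conj, conjVec_conjVec]

/-- **Transversality of the Fourier coefficients**: `k · coef k = 0` on `λΛ`. [cite: LuoTiti2020, §3.2 Prop. 1] -/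
theorem isTransversal_coef (n : ℤ) (a : LIndex → ℂ) : IsTransversal (freqSet n) (coef n a) := by
  intro k _
  simp only [coef, WithLp.ofLp_sum, Finset.sum_apply, Finset.mul_sum]
  rw [Finset.sum_comm]
  refine Finset.sum_eq_zero fun y hy => ?_
  have hk : kvec n y = k := (Finset.mem_filter.mp hy).2
  have h0 := sum_kvec_mul_bvec n y
  rw [hk] at h0
  calc ∑ j, (k j : ℂ) * (a y • bvec y) j = a y * ∑ j, ((k j : ℤ) : ℂ) * bvec y j := by
        rw [Finset.mul_sum]
        refine Finset.sum_congr rfl fun j _ => ?_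
        rw [PiLp.smul_apply, smul_eq_mul]
        ring
    _ = 0 := by rw [h0, mul_zero]

/-- **The Beltrami field `W = ∑_{ξ ∈ Λ} a_ξ B_ξ e_{λξ}` on `T³`, real form** (`λ = 5n`): the
real trigonometric polynomial with frequency set `λΛ` and coefficients `coef n a`. For
coefficient families with the reality condition this IS the printed complex field
(`complexify_beltramiField`). [cite: LuoTiti2020, §3.2 Prop. 1] -/
def beltramiField (n : ℤ) (a : LIndex → ℂ) : 𝕋³ → ℝ³ :=
  realTrigPoly (freqSet n) (coef n a)

/-- The complex trigonometric polynomial behind `W`, as the printed sum over directions: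
`trigPoly (λΛ) coef x = ∑_ξ (a_ξ e_{λξ}(x)) • B_ξ`. [cite: LuoTiti2020, §3.2 Prop. 1] -/
theorem trigPoly_coef_eq_sum (n : ℤ) (a : LIndex → ℂ) (x : 𝕋³) :
    trigPoly (freqSet n) (coef n a) x = ∑ y : LIndex, (a y * mFourier (kvec n y) x) • bvec y := by
  rw [trigPoly_apply, ← Finset.sum_fiberwise_of_maps_to (s := Finset.univ) (t := freqSet n)
    (g := kvec n) (fun y _ => Finset.mem_image_of_mem _ (Finset.mem_univ y))
    (fun y => (a y * mFourier (kvec n y) x) • bvec y)]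
  refine Finset.sum_congr rfl fun k _ => ?_
  rw [coef, Finset.smul_sum]
  refine Finset.sum_congr rfl fun y hy => ?_
  rw [(Finset.mem_filter.mp hy).2, smul_smul, mul_comm]

/-- **`W` is real-valued**: under the reality condition `a_{-ξ} = ā_ξ`,
`complexify (W x) = ∑_ξ (a_ξ e_{λξ}(x)) • B_ξ` — the printed complex field takes real values
and `W` is that field. [cite: LuoTiti2020, §3.2 Prop. 1] -/
theorem complexify_beltramiField {a : LIndex → ℂ} (ha : IsCoefSymm a) (n : ℤ) (x : 𝕋³) :
    complexify (beltramiField n a x) = ∑ y : LIndex, (a y * mFourier (kvec n y) x) • bvec y := by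
  rw [beltramiField, complexify_realTrigPoly (fun _ hk => neg_mem_freqSet hk) (isConjSymm_coef ha n),
    trigPoly_coef_eq_sum]

/-- `W` is smooth. [folklore] -/
theorem isSmooth_beltramiField (n : ℤ) (a : LIndex → ℂ) : IsSmooth (beltramiField n a) :=
  isSmooth_realTrigPoly _ _

/-- **`W` is divergence free** (`(λξ) · a_ξB_ξ = 0`). [cite: LuoTiti2020, §3.2 Prop. 1] -/
theorem isDivFree_beltramiField (n : ℤ) (a : LIndex → ℂ) : IsDivFree (beltramiField n a) :=
  isDivFree_realTrigPoly (isTransversal_coef n a)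

/-- **Fourier coefficients of `W`**: `coef k` on `λΛ`, `0` off it (reality condition assumed).
[cite: LuoTiti2020, §3.2 Prop. 1] -/
theorem mFourierCoeff_beltramiField {a : LIndex → ℂ} (ha : IsCoefSymm a) (n : ℤ) (k : Fin 3 → ℤ) :
    mFourierCoeff (complexify ∘ beltramiField n a) k = if k ∈ freqSet n then coef n a k else 0 :=
  mFourierCoeff_realTrigPoly (fun _ hk => neg_mem_freqSet hk) (isConjSymm_coef ha n) k

/-- Off `λΛ` the Fourier coefficients of `W` vanish: `W` is frequency-localised on `|k| = 5|n|`.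
[cite: LuoTiti2020, §3.2 (3.5)] -/
theorem mFourierCoeff_beltramiField_eq_zero {a : LIndex → ℂ} (ha : IsCoefSymm a) (n : ℤ)
    {k : Fin 3 → ℤ} (hk : k ∉ freqSet n) : mFourierCoeff (complexify ∘ beltramiField n a) k = 0 := by
  rw [mFourierCoeff_beltramiField ha, if_neg hk]

/-- **`L²` identity**: `∫_{T³} ‖W‖² = ∑_{ξ ∈ Λ} |a_ξ|²` for `n ≠ 0` (finite Parseval and
`|B_ξ| = 1`) — the trace of the printed `⨍ W ⊗ W = ½∑|a_ξ|²(Id - ξ⊗ξ)`.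
[cite: LuoTiti2020, §3.2 Prop. 1] -/
theorem integral_norm_sq_beltramiField {a : LIndex → ℂ} (ha : IsCoefSymm a) {n : ℤ} (hn : n ≠ 0) :
    ∫ x, ‖beltramiField n a x‖ ^ 2 = ∑ y : LIndex, ‖a y‖ ^ 2 := by
  rw [beltramiField, integral_norm_sq_realTrigPoly (fun _ hk => neg_mem_freqSet hk) (isConjSymm_coef ha n),
    freqSet, Finset.sum_image fun y _ y' _ h => kvec_injective hn h]
  refine Finset.sum_congr rfl fun y _ => ?_
  rw [coef_kvec hn, norm_smul, norm_bvec, mul_one]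

end Literature.Analysis.FluidPDE.IntermittentBeltrami
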